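import Literature.NumberTheory.Weil1965.LocalQuadraticGaussTransformDecayMax
import Literature.NumberTheory.Weil1965.LocalQuadraticFibreDensityHomogeneity
import Mathlib.LinearAlgebra.QuadraticForm.IsometryEquiv
import HarnessLib

/-!
# Decay of the Gauss transform of a GENERAL non-degenerate quadratic form over a non-archimedean local field

Topic `NumberTheory/Weil1965`; namespace `Literature.NumberTheory.Weil1965`.  KERNEL mathematics only (theorems; no
definition, no named fact, no `axiom`, no proof hole).  Sequel of `LocalQuadraticGaussTransformDecayMax.lean` and
`LocalQuadraticFibreDensityHomogeneity.lean`.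

The decay files treat DIAGONAL forms `Σ cᵢ xᵢ²`.  For an ARBITRARY non-degenerate quadratic form `Q` on `F^ι` (char `F ≠ 2`)
the classical diagonalisation over a field (an orthogonal basis: Mathlib's
`QuadraticForm.equivalent_weightedSumSquares_units_of_nondegenerate'`), re-indexed back to the SAME index type `ι`, gives a
linear automorphism `e` of `F^ι` and non-zero `cᵢ` with `Q(x) = Σ cᵢ (e x)ᵢ²` (`exists_linearEquiv_eq_sum_sq`; [Weil1964,
Chap. II n° 25: "formes équivalentes"]).  The change of variables `y = e x` (module `‖det e‖`, ★ `integral_comp_linearEquiv`)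
then transfers Weil's decay estimate [Weil1965, Chap. I n° 2 Prop. 2] to `Q`:

  `‖∫ Φ(x) ψ(β Q(x)) dμ^⊗ι‖ ≤ C · max(1, ‖β‖)^{-r/2}`   for every `β ∈ F`, every Schwartz–Bruhat `Φ` (`r = card ι`)

(`exists_norm_integral_mul_addChar_quadraticForm_le_max_rpow`) — the local bound at the finitely many ramified places of the
Euler-product majorant in Weil's condition (B), for the quadratic forms `x ↦ xᵀ T x` with `T` an arbitrary invertible
symmetric matrix that the Siegel–Weil stubs quantify over.

## References

* [Weil1965] A. Weil, *Sur la formule de Siegel dans la théorie des groupes classiques*, Acta Math. 113 (1965) 1–87: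
  Chap. I n° 2 Prop. 2 (p. 8).
* [Weil1964] A. Weil, *Sur certains groupes d'opérateurs unitaires*, Acta Math. 111 (1964) 143–211: Chap. II n° 25
  (p. 173: equivalent forms).
-/

set_option autoImplicit false

noncomputable section

open MeasureTheory ValuativeRel Filter Topology Set
open scoped NNReal ENNReal Pointwise
open Literature.NumberTheory.GaloisRepresentations.IsNonarchimedeanLocalField
open Literature.NumberTheory.Automorphic
open Literature.NumberTheory.Weil1964

namespace Literature.NumberTheory.Weil1965

variable {F : Type*} [Field F]

/-! ## §1 Diagonalisation on the same index type -/

section Diagonal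

variable {ι : Type*} [Fintype ι] [Invertible (2 : F)]

/-- **diagonalisation of a non-degenerate quadratic form on `F^ι`, on the SAME index type**: there are a linear
automorphism `e` of `F^ι` and non-zero `cᵢ` with `Q(x) = Σ cᵢ (e x)ᵢ²` (an orthogonal basis, re-indexed along
`ι ≃ Fin (dim)`). [cite: Weil1964, Chap. II n° 25, p. 173] -/
theorem exists_linearEquiv_eq_sum_sq (Q : QuadraticForm F (ι → F))
    (hQ : (QuadraticMap.associated (R := F) Q).SeparatingLeft) :
    ∃ (e : (ι → F) ≃ₗ[F] (ι → F)) (c : ι → F), (∀ i, c i ≠ 0) ∧ ∀ x, Q x = ∑ i, c i * (e x) i ^ 2 := by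
  obtain ⟨w, ⟨iso⟩⟩ := Q.equivalent_weightedSumSquares_units_of_nondegenerate' hQ
  let σ : ι ≃ Fin (Module.finrank F (ι → F)) :=
    (Fintype.equivFin ι).trans (finCongr (Module.finrank_fintype_fun_eq_card F).symm)
  refine ⟨iso.toLinearEquiv.trans (LinearEquiv.funCongrLeft F F σ), fun i => (w (σ i) : F), fun i => (w (σ i)).ne_zero,
    fun x => ?_⟩
  rw [← iso.map_app x, QuadraticMap.weightedSumSquares_apply, ← Equiv.sum_comp σ]
  refine Finset.sum_congr rfl fun i _ => ?_
  rw [LinearEquiv.trans_apply, LinearEquiv.funCongrLeft_apply, LinearMap.funLeft_apply, Units.smul_def, smul_eq_mul, sq]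
  rfl

end Diagonal

/-! ## §2 The decay for a general non-degenerate form -/

section Decay

variable [ValuativeRel F] [TopologicalSpace F] [IsNonarchimedeanLocalField F]
variable {ι : Type*} [Fintype ι] [MeasurableSpace F] [BorelSpace F] (μ : Measure F) [μ.IsAddHaarMeasure]
  {ψ : AddChar F Circle}

/-- **change of variables to the diagonal form**: if `Q(x) = Σ cᵢ (e x)ᵢ²` then
`∫ Φ(x) ψ(β Q(x)) dμ^⊗ι = ‖det e‖⁻¹ · ∫ Φ(e⁻¹ y) ψ(β Σ cᵢ yᵢ²) dμ^⊗ι(y)`. [cite: Weil1964, Chap. II n° 25, p. 173] -/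
theorem integral_mul_addChar_eq_of_eq_sum_sq (Φ : (ι → F) → ℂ) {Q : (ι → F) → F} (e : (ι → F) ≃ₗ[F] (ι → F))
    (c : ι → F) (hQ : ∀ x, Q x = ∑ i, c i * (e x) i ^ 2) (β : F) :
    ∫ x, Φ x * ((ψ (β * Q x) : Circle) : ℂ) ∂(Measure.pi fun _ : ι => μ) =
      ((normAbs F (LinearMap.det (e : (ι → F) →ₗ[F] (ι → F)))⁻¹ : ℝ≥0) : ℝ) •
        ∫ y, Φ (e.symm y) * psiSqPi ψ (fun i => β * c i) y ∂(Measure.pi fun _ : ι => μ) := by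
  rw [← integral_comp_linearEquiv μ e]
  refine integral_congr_ae (Eventually.of_forall fun x => ?_)
  simp only [LinearEquiv.symm_apply_apply, psiSqPi_smul_apply, hQ x]

/-- **WEIL'S DECAY ESTIMATE FOR A GENERAL NON-DEGENERATE QUADRATIC FORM** over a `p`-field (`2 ≠ 0`): for `ψ` of
conductor exponent `d`, `‖2‖ = q^{-v₂}`, `Q` a quadratic form on `F^ι` with non-degenerate associated bilinear form, and
a Schwartz–Bruhat `Φ`, there is `C ≥ 0` with `‖∫ Φ(x) ψ(β Q(x)) dμ^⊗ι‖ ≤ C · max(1, ‖β‖)^{-r/2}` for every `β`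
(`r = card ι`). [cite: Weil1965, Chap. I n° 2 Prop. 2, p. 8] -/
theorem exists_norm_integral_mul_addChar_quadraticForm_le_max_rpow [Invertible (2 : F)] {d : ℤ}
    (hd : ψ.HasConductorExp d) {v₂ : ℤ} (h2 : normAbs F (2 : F) = (residueFieldCard F : ℝ≥0)⁻¹ ^ v₂)
    (Q : QuadraticForm F (ι → F)) (hQ : (QuadraticMap.associated (R := F) Q).SeparatingLeft)
    {Φ : (ι → F) → ℂ} (hΦ : Φ ∈ SchwartzBruhat (ι → F)) :
    ∃ C : ℝ, 0 ≤ C ∧ ∀ β : F,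
      ‖∫ x, Φ x * ((ψ (β * Q x) : Circle) : ℂ) ∂(Measure.pi fun _ : ι => μ)‖ ≤
        C * ((max 1 (normAbs F β) : ℝ≥0) : ℝ) ^ (-((Fintype.card ι : ℝ) / 2)) := by
  obtain ⟨e, c, hc, hQe⟩ := exists_linearEquiv_eq_sum_sq Q hQ
  have hΦ' : (Φ ∘ e.symm) ∈ SchwartzBruhat (ι → F) := comp_linearEquiv_mem_schwartzBruhat hΦ e.symm
  obtain ⟨C, hC0, hC⟩ := exists_norm_integral_mul_psiSqPi_le_max_rpow μ hd h2 hc hΦ'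
  set D : ℝ := ((normAbs F (LinearMap.det (e : (ι → F) →ₗ[F] (ι → F)))⁻¹ : ℝ≥0) : ℝ) with hDdef
  have hD0 : 0 ≤ D := NNReal.coe_nonneg _
  refine ⟨D * C, mul_nonneg hD0 hC0, fun β => ?_⟩
  rw [integral_mul_addChar_eq_of_eq_sum_sq μ Φ e c hQe β, norm_smul, Real.norm_of_nonneg hD0, mul_assoc]
  exact mul_le_mul_of_nonneg_left (hC β) hD0

end Decay

end Literature.NumberTheory.Weil1965
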